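import Summits.QuantumFields.YangMills.Theorems.BalabanUVNodesN12CouplingStepOfBetaSign
import Summits.QuantumFields.YangMills.Theorems.BalabanUVNodesN12AtRecord13TermPinnedLambdaChi

/-!
# BalabanUVNodes ∕ N12 — χ-GENERIC RE-ISSUE (RC-1 «RE-CENTRE THE RECORD», director-ym №462 (B) ∕ №467 (D)) of `…N12CouplingStepOfBetaSign` §1: THE COUPLING STEP OF THE
# `N₀`-EQUATION FROM THE β-SIGN BOX along the χ-generic history `gOfRecord₁₃Chi θL χ P` (`θL := Θ.liveRepin₁₃Chi χ`)

Cell `pub-ymgap` (HUMAN RULING D-0062), seat `pub-ymgap-dag-n12-d` g36 (R134 N12 [B15] s2 «knit at the record»).  Sibling of `BalabanUVNodesN12CouplingStepOfBetaSign` (this seat).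

WHY.  The route's K-cruxes read the RE-CENTRED record since rev 31∕32 ([Ax-2]∕[Ax-3]: `Node00/SmallFieldChi29AxOfRecord`, `Node00/Record13{Ax,Chi,CoPHChi,SepCoPHChi}` — the
Stage-13 chain re-issued GENERIC in the β-slot `χ : ChiSlot F N`; node00-def-Y's `Node00/Record13LiveSelectorChi` — the live re-pin `liveRepin₁₃Chi θ χ` and `Record13` §4c's
rows in the χ slot).  This seat's kernel σ-closure of N12's junction of record (`N12-SIGMA-CLOSURE-Ax.g36.md`, evidence #2 on 27239; dag-lead g40 WORDS 584 ∕ HANDS-3 addendum: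
«N12 road at the re-centred record = dag-n12-d's lane») lists the 13 N12-side statements that read the (2.9) centre, in 8 modules; THIS FILE is the sibling of ONE of them,
re-issuing its Record-13-keyed theorems VERBATIM under the token map σ = (`Θ.liveRepin₁₃ ↦ Θ.liveRepin₁₃Chi … χ`, `gOfRecord₁₃ ↦ gOfRecord₁₃Chi … χ`, `reprTOfRecord₁₃ ↦
reprTOfRecord₁₃Chi … χ`, `EOfRecord₁₃ ↦ EOfRecord₁₃Chi … χ`, `WOfRecord₁₃ ↦ WOfRecord₁₃Chi … χ`, `Provisos₁₃ ↦ Provisos₁₃Chi … χ`, `betaOfRecord₁₃ ↦ betaOfRecord₁₃Chi … χ`,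
`pinRPrime₁₃ ↦ pinRPrime₁₃Chi … χ`, `N0OfRecord₁₃ ↦ N0OfRecord₁₃Chi … χ`; K0a faces `↦ …Chi_…`), same short names in the sibling namespace (dag-n11-d's convention; consumers
switch by namespace).  dag-n11-e's three live-selector wrappers (`ppSel_succ_idem_of_liveSel`, `liveRepin₁₃_liveSel`, `rstep₁₃_of_liveSel_of_hasResiduals`) are NOT
restated: their one-line bodies over the history-generic NODE 00 lemmas (`ppSelLiveOfRecord_succ_idem`, `rfl`, `rstep₁₃_of_localBg_liveSel_chi`) are inlined.  At
`χ := chiβOfRecord₁₃ Θ` every theorem IS the parent's (definitionally, [Ax-3b]'s `rfl` receipts); at `χ := chiβOfRecord₁₃Ax Θ` it is what the re-centred record's N12 road reads.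
Nothing of record edited (body-freeze №460 (2)).

HONEST FRAMING.  Kernel bookkeeping BY NAME, χ-generic (definitions over the β-slot parameter + the parents' proofs verbatim); the displayed rows of the parent stay DISPLAYED;
nothing of Bałaban's asserted; N12 NOT discharged; K0ᴬ ∕ K1ᴬ ∕ K3ᴬ OPEN; counts unmoved; one finite 𝕋⁴ programme at fixed `ε = L^{-K}` — NOT continuum ∕ ℝ⁴ ∕ OS; NOT the
Yang–Mills mass gap (Clay).  THEOREMS ONLY (0 `def`, 0 `instance`, 0 `sorry`).  Filed `--kind proof --supports stmt-QuantumFields-27239 --as helper` (K1ᴬ, route rev 31∕32).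
Sources (bookkeeping only): [Balaban1989LargeFieldI] (0.2)–(0.6) pp.176–177, Prop. 1 (1.78) p.194, (1.80) p.195, (1.89) p.198, (1.99)–(1.102) pp.200–201;
[Balaban1988Convergent] (2.18) p.257, (3.22)–(3.25) pp.269–270; [Balaban1987RG1] (0.17)–(0.20) pp.255–256, (2.9) p.266 (the cut-off's centre).
-/

noncomputable section

open scoped BigOperators ENNReal
open MeasureTheory
open scoped Matrix.Norms.L2Operator

namespace Summit.QuantumFields.YangMills.BalabanUVNodes.N12CouplingStepOfBetaSignChi

open Literature.MathematicalPhysics.QuantumFieldTheory.Balaban1983to89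
open Literature.MathematicalPhysics.QuantumFieldTheory.Balaban1983to89.T4Continuum (T4Family)
open Literature.MathematicalPhysics.QuantumFieldTheory.Balaban1983to89.DagBinding (PrintedCarriers15 B15Leaf)
open Literature.MathematicalPhysics.QuantumFieldTheory.Balaban1983to89.Node00
open B15Claim189Assembly (Setting189 new189 chiPP dom half)
open B15 (Prop1Printed Ineq180)
open B15.BasicStep (Claim189)
open B15.PrelimIntegrations (Ineq191 Ineq195)
open B15Chi124DetSets (E124)
open B15DeterminingSets (MSField)
open B14DomainGeom (Pt)
open B8Eq17ClassAkV1 (plaqsOf)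
open GaugeGroup (dist1)
open GaugeField (plaqHol)
open B15Claim189PrintedConditions (omegaOfChain)
open B15Claim189PinsOfHistory (sitOfHist N0OfRecord₁₃ D189OfHist two_le_N0OfSeq_of_hist)
open B15Claim189LambdaPin (enlD)
open B15Claim189FlowAtRecord (epsOfRecord_nonneg_of_inInterval)
open FlowStep (BetaLowerH)
open B15Claim189N0OfRecord (genSeq_le_succ_of_beta_nonneg betaAlongHistory_nonneg_of_betaLowerH)
open Summit.QuantumFields.YangMills.BalabanUVNodes.N12AtRecord13TermPinnedLambdaChi (b15Leaf_WOfRecord₁₃_pinAllΛ_N0_liveRepin₁₃_of_massLive_of_hasResiduals_of_flow)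
open B15Claim189PinsOfHistory (N0OfRecord₁₃Chi)

variable {N : ℕ} [NeZero N] {F : T4Family}

section LeafChi
variable (Θ : Stage13Params F N) (χ : ChiSlot F N) (lam : ResidW F N) (σ : ∀ P : B12.RunParams, Sit189 F N P.K)
  (s : ∀ P : B12.RunParams, SeqOfRecord F Θ.ν Θ.τ9.M (gOfRecord₁₃Chi F N (Θ.liveRepin₁₃Chi F N χ) χ P) P.K (lam.kSel P + 1)) (Nm : B12.RunParams → ℕ) (p₁ : ℕ)

/-- **★★ 12I's WINDOW-FREE `Λ`-PINNED ROW AT `θL := Θ.liveRepin₁₃` WITH THE COUPLING STEP DISCHARGED**: `hgpos ∕ hgstep ∕ hgle` of the `N₀`-equation's one step are read off the run's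
window up to the torus (`hI : 0 < g_j ≤ γ`, `j ≤ K`; `hγ1 : γ ≤ 1`) and the β-sign leaf on the box `]0, γ]` (`hlow`, `0 ≤ b`: one step of (0.20) with `β ≥ 0` gives `g_m ≤ g_{m+1}`,
`m < K` — K0a FILE 13e's `hmono_of_betaLowerH`, `γ`-generic), at the index `m = k′ + 1 − N₀ < K` (`2 ≤ N₀` from `hlog` by dag-n12-e's `two_le_N0OfSeq_of_hist`, `N₀ ≤ k′` = `hNk`).  Every other display as in 12I §1. [cite: Balaban1989LargeFieldI, (0.2)–(0.6) p.176, (1.73) p.192, Prop. 1 (1.78) p.194, (1.80) p.195, (1.88)–(1.90) pp.197–198, pp.199–201; Balaban1987RG1, (0.20) p.256, §1 p.264; Balaban1988Convergent, (2.1)–(2.8) pp.254–256, (3.16) p.268, (3.22)–(3.25) pp.269–270] -/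
theorem b15Leaf_WOfRecord₁₃_pinAllΛ_N0_liveRepin₁₃_of_massLive_of_hasResiduals_of_flow_of_betaLowerH (hres : Θ.HasResidualsOfRecord F N)
    {P : B12.RunParams} (hK : lam.kSel P < P.K) (hsh : 0 < (σ P).sh) (hM : 0 < Θ.τ9.M)
    {D : Setting189 (F.P P.K) (SU N) (MSField (F.P P.K) (SU N) × ((j : ℕ) → VecField (F.P P.K) j (EuclideanSpace ℝ (Fin (N ^ 2 - 1))))) (Pt (F.P P.K).d)}
    (hD : D = ((lam.pinRPrime₁₃Chi (Θ.liveRepin₁₃Chi F N χ) χ).pinD189ΛH (Θ.liveRepin₁₃Chi F N χ).ν (Θ.liveRepin₁₃Chi F N χ).A₁ (Θ.liveRepin₁₃Chi F N χ).τ9.M (gOfRecord₁₃Chi F N (Θ.liveRepin₁₃Chi F N χ) χ) σ s Nm p₁).D189 P)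
    (hmassLive : ∀ a, LiveSeq F N Θ.ν Θ.τ9 P (gOfRecord₁₃Chi F N (Θ.liveRepin₁₃Chi F N χ) χ P) (lam.kSel P + 1)
        (slotsTOfRecord F N Θ.ν Θ.τ9 (EOfRecord₁₃Chi F N (Θ.liveRepin₁₃Chi F N χ) χ) (wOfRecord₉ F N (Θ.liveRepin₁₃Chi F N χ).toStage9Params)
          (Θ.liveRepin₁₃Chi F N χ).ppSel P (gOfRecord₁₃Chi F N (Θ.liveRepin₁₃Chi F N χ) χ P) (lam.kSel P + 1)) a →
      0 < ∫ V, rterm (reprTOfRecord₁₃Chi F N (Θ.liveRepin₁₃Chi F N χ) χ P (lam.kSel P)) a V ∂(fieldMeasure (F.P P.K) (lam.kSel P + 1) (SU N)))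
    (hP1 : Prop1Printed (lam.LF P))
    (hlog : 1 < (Real.log (gOfRecord₁₃Chi F N (Θ.liveRepin₁₃Chi F N χ) χ P (lam.kSel P + 1) ^ 2)⁻¹) ^ Θ.ν.r)
    (hNN : N0OfRecord₁₃Chi (Θ.liveRepin₁₃Chi F N χ) χ P (lam.kSel P + 1) ≤ Nm P) (hNk : N0OfRecord₁₃Chi (Θ.liveRepin₁₃Chi F N χ) χ P (lam.kSel P + 1) ≤ lam.kSel P + 1)
    (hβ0 : 0 ≤ (σ P).β) (hβ : (σ P).β ≤ 1 / 4) (hL₀ : 2 ≤ (σ P).L₀) (hL₀L : (σ P).L₀ ^ 2 ≤ ((F.P P.K).L : ℝ))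
    (hB : 0 ≤ (σ P).O1 * (σ P).B₃ * (σ P).B₅) (hδ : 0 ≤ (σ P).δ)
    (hN₀ : (2 + (121 / 120) ^ 2 * ((σ P).O1 * (σ P).B₃ * (σ P).B₅ * (Θ.τ9.M : ℝ) ^ 5)) *
      ((((σ P).L₀ ^ 2) ^ (N0OfRecord₁₃Chi (Θ.liveRepin₁₃Chi F N χ) χ P (lam.kSel P + 1) - 1))⁻¹) ≤ 1 / 4)
    (hMl : (121 / 120) ^ 2 * ((σ P).O1 * (σ P).B₃ * (σ P).B₅ * (Θ.τ9.M : ℝ) ^ 5) * Real.exp (-(4 * (σ P).δ * (Θ.τ9.M : ℝ))) ≤ 1 / 12)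
    (hε0 : ∀ i, lam.kSel P + 1 - Nm P ≤ i → i ≤ lam.kSel P + 1 → 0 ≤ epsOfRecord Θ.ν (gOfRecord₁₃Chi F N (Θ.liveRepin₁₃Chi F N χ) χ P) i)
    (hε1 : ∀ i, lam.kSel P + 1 - Nm P ≤ i → i ≤ lam.kSel P + 1 → epsOfRecord Θ.ν (gOfRecord₁₃Chi F N (Θ.liveRepin₁₃Chi F N χ) χ P) i ≤ 1 / 10)
    {β₀ : ℝ} (hβ₀0 : 0 ≤ β₀) (hβ₀ : β₀ ≤ 1 / 2)
    (hflow : ∀ j, lam.kSel P + 1 - Nm P ≤ j → j < lam.kSel P + 1 → epsOfRecord Θ.ν (gOfRecord₁₃Chi F N (Θ.liveRepin₁₃Chi F N χ) χ P) (lam.kSel P + 1)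
      ≤ (1 + β₀) * Real.sqrt ((lam.kSel P + 1 - j : ℕ) : ℝ) * epsOfRecord Θ.ν (gOfRecord₁₃Chi F N (Θ.liveRepin₁₃Chi F N χ) χ P) j)
    -- NEW (this file): the window of the run up to the torus and the β-sign leaf on the window box REPLACE the coupling-step displays `hgpos hgstep hgle`
    {b γ : ℝ} (hb : 0 ≤ b) (hlow : BetaLowerH b γ (betaOfRecord₁₃Chi F N (Θ.liveRepin₁₃Chi F N χ) χ)) (hγ1 : γ ≤ 1)
    (hI : Step.InInterval γ P.K (gOfRecord₁₃Chi F N (Θ.liveRepin₁₃Chi F N χ) χ P))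
    (hΛ : (((enlD F Θ.ν Θ.τ9.M P (gOfRecord₁₃Chi F N (Θ.liveRepin₁₃Chi F N χ) χ P)) 4 (lam.kSel P + 1 + 1 - (N0OfRecord₁₃Chi (Θ.liveRepin₁₃Chi F N χ) χ P (lam.kSel P + 1)))
        (omegaOfChain (s P) (lam.kSel P + 1 + 1 - (N0OfRecord₁₃Chi (Θ.liveRepin₁₃Chi F N χ) χ P (lam.kSel P + 1)))))ᶜ ∩ (σ P).Z).Nonempty)
    (L91h : ∀ U, new189 D U → ∀ p ∈ plaqsOf (half D),
      Ineq191 (dist1 (plaqHol (D.Upp U) p)) (D.devV'' U p) D.α ((D.L ^ D.h)⁻¹) (D.ε D.h) (E124 D.ε D.L D.η D.k D.h))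
    (L95 : ∀ U, new189 D U → ∀ p ∈ plaqsOf (half D),
      Ineq195 (D.devV'' U p) (dist1 (plaqHol (D.Uhalf U (D.boxOf p)) p)) D.α ((D.L ^ D.h)⁻¹) (D.ε D.h) (E124 D.ε D.L D.η D.k D.h))
    (L91 : ∀ U, new189 D U → ∀ j, D.h ≤ j → j ≤ D.k → ∀ p ∈ plaqsOf (dom D j),
      Ineq191 (dist1 (plaqHol (D.Upp U) p)) (D.dev97 U p) D.α ((D.L ^ j)⁻¹) (D.ε j) (E124 D.ε D.L D.η D.k j))
    (L97 : ∀ U, new189 D U → ∀ j, D.h ≤ j → j ≤ D.k → ∀ p ∈ plaqsOf (dom D j),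
      Ineq191 (D.dev97 U p) (D.dev0 U p) D.α ((D.L ^ j)⁻¹) (D.ε j) (E124 D.ε D.L D.η D.k j))
    (L80 : ∀ U, new189 D U → ∀ j, D.h ≤ j → j ≤ D.k → ∀ p ∈ plaqsOf (dom D j),
      Ineq180 (D.dev0 U p) (D.ε D.k) D.η D.B₃ D.B₅ D.M D.δ (D.dist p) D.O1) :
    B15Leaf (WOfRecord₁₃Chi F N (Θ.liveRepin₁₃Chi F N χ) χ
      ((lam.pinRPrime₁₃Chi (Θ.liveRepin₁₃Chi F N χ) χ).pinD189ΛH (Θ.liveRepin₁₃Chi F N χ).ν (Θ.liveRepin₁₃Chi F N χ).A₁ (Θ.liveRepin₁₃Chi F N χ).τ9.M (gOfRecord₁₃Chi F N (Θ.liveRepin₁₃Chi F N χ) χ) σ s Nm p₁) P) := by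
  have hN2 : 2 ≤ N0OfRecord₁₃Chi (Θ.liveRepin₁₃Chi F N χ) χ P (lam.kSel P + 1) := two_le_N0OfSeq_of_hist Θ.ν P _ hlog
  have hm : lam.kSel P + 1 + 1 - N0OfRecord₁₃Chi (Θ.liveRepin₁₃Chi F N χ) χ P (lam.kSel P + 1) < P.K := by omega
  have hidx : lam.kSel P + 1 + 1 - N0OfRecord₁₃Chi (Θ.liveRepin₁₃Chi F N χ) χ P (lam.kSel P + 1) + 1 = lam.kSel P + 1 + 2 - N0OfRecord₁₃Chi (Θ.liveRepin₁₃Chi F N χ) χ P (lam.kSel P + 1) := by omega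
  -- one step of [I] (0.20) with `β ≥ b ≥ 0` at the prefix (in the box by the window): K0a FILE 13e's argument, `γ`-generic
  have hstep := genSeq_le_succ_of_beta_nonneg (betaOfRecord₁₃Chi F N (Θ.liveRepin₁₃Chi F N χ) χ) P.g0 (hI _ hm.le).1 (hI _ hm).1
    (betaAlongHistory_nonneg_of_betaLowerH hb hlow hI _ hm)
  rw [hidx] at hstep
  exact b15Leaf_WOfRecord₁₃_pinAllΛ_N0_liveRepin₁₃_of_massLive_of_hasResiduals_of_flow Θ χ lam σ s Nm p₁ hres hK hsh hM hD hmassLive hP1 hlog hNN hNk hβ0 hβ hL₀ hL₀L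
    hB hδ hN₀ hMl hε0 hε1 hβ₀0 hβ₀ hflow (hI _ hm.le).1 hstep ((hI _ (by omega)).2.trans hγ1) hΛ L91h L95 L91 L97 L80

end LeafChi

end Summit.QuantumFields.YangMills.BalabanUVNodes.N12CouplingStepOfBetaSignChi

end
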